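import Literature.Geometry.Riemannian.MetricFlowWassersteinMonotoneGeneral
import Literature.Geometry.Riemannian.MetricFlowSliceUnion
import Literature.Geometry.Riemannian.RicciFlowThroughSingularitiesFour
import HarnessLib

/-!
# `P*`-parabolic neighbourhoods of a metric flow: forward/backward balls, time-slices and the
# containment relations (Bamler 2020a, §9.1, Def. 9.1–9.2, Prop. 9.3; Bamler 2023, §3.5)

R. Bamler, *Entropy and heat kernel bounds on a Ricci flow background*, arXiv:2008.07093, §9.1,
Def. 9.1: for `A, T^± ≥ 0` with `t₀ − T⁻ ∈ I`, *"`P*(x₀, t₀; A, −T⁻, T⁺)` is the set of points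
`(x, t) ∈ M × I` with `t ∈ [t₀ − T⁻, t₀ + T⁺]` and
`d^{g_{t₀−T⁻}}_{W₁}(ν_{x₀,t₀;t₀−T⁻}, ν_{x,t;t₀−T⁻}) < A`"*; Def. 9.2: `P*(x₀, t₀; r) :=
P*(x₀, t₀; r, −r², r²)`, `P*^±(x₀, t₀; r)` (forward: `T⁻ = 0`, backward: `T⁺ = 0`); Prop. 9.3
(a)–(d): the containment relations (`P*(x₁, t₁; A, 0, 0) = B(x₁, t₁, A) × {t₁}`; monotonicity in
`A, T^±`; symmetry with `2A`; transitivity with `A₁ + A₂`; two intersecting balls,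
`P*(x₁; r₁) ⊂ P*(x₂; 2r₁ + r₂)`), proved in §9.2 from the monotonicity of `t ↦ d^{g_t}_{W₁}`
between conjugate heat kernels (§2.4, Lemma) and the triangle inequality. Bamler 2023
(*Compactness theory …*), §3.5 has the same notions and Proposition on a METRIC FLOW (*"its proof
carries over to the setting of metric flows"*).

The metric-flow definitions `MetricFlow.pParabolicNhd x A T⁻ T⁺ h` / `MetricFlow.pParabolicBall`
(points of `𝒳` = the Σ-type `𝒳.Pt`, `h : 𝔱(x) − T⁻ ∈ I`) are already in the tree
(`RicciFlowThroughSingularitiesFour.lean`). This file adds: the definitions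
`MetricFlow.pParabolicBallFwd`, `MetricFlow.pParabolicBallBwd` (**Def. 9.2**, `P*⁺`, `P*⁻`) and
`MetricFlow.pParabolicNhdSlice` (the time-slices `S_t := P* ∩ 𝒳_t` of (9.7), whose volume
Theorem 9.8 bounds); `IsHConcentrated.wassersteinW1_condKernel_mono'` —
`s ↦ d^{𝒳_s}_{W₁}(ν_{x₁;s}, ν_{x₂;s})` is non-decreasing for `x₁ ∈ 𝒳_{t₁}`, `x₂ ∈ 𝒳_{t₂}` at two
possibly DIFFERENT times (§2.4, Lemma = Bamler 2023, §3.2, Proposition (b) for the two conjugate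
heat kernels) — and `wassersteinW1_condKernel_le_add` (the display proving Prop. 9.3 (c));
membership lemmas and `mem_pParabolicNhd_self`; **(a)** `pParabolicNhdSlice_zero_zero_self`,
`fst_eq_of_mem_pParabolicNhd_zero_zero`; **(b)** `IsHConcentrated.pParabolicNhd_mono`; **(bb)**
`IsHConcentrated.mem_pParabolicNhd_comm`, `….pParabolicNhd_subset_of_mem_comm`; **(c)**
`IsHConcentrated.pParabolicNhd_subset_of_mem`; **(d)**
`IsHConcentrated.pParabolicNhd_subset_of_mem_of_mem` — each with free target parameters (only
`A₁ + A₂ ≤ A`, `T₁⁻ + T₂⁻ ≤ T⁻`, … are required, so that no intermediate neighbourhood has to be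
defined) — and the ball versions of the source (`√2 r`, `2r`, `r₁ + r₂`, `2r₁ + r₂`).

`H`-concentration (any `H`) is assumed in (b)–(d): it makes all variances finite, which is how
the tree proves the `W₁`-monotonicity (`IsConjugateHeatFlow.wassersteinW1_mono_of_variance_ne_top`);
the metric flow of a Ricci flow on a closed manifold is `H_n`-concentrated. No sign conditions on
`A`, `r` are needed (an inhabited neighbourhood has `A > 0`).
-- TODO(general form): the forward/backward-ball versions of (c), (d) ("if `t₁ ≥ t₂` or
-- `t₁ ≤ t₂`") and (b)–(d) assuming only finite variances instead of `H`-concentration.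

## References

* R. H. Bamler, *Entropy and heat kernel bounds on a Ricci flow background*, arXiv:2008.07093
  (2020), §2.4, Lemma (monotonicity of the `W₁`-distance); §9.1, Def. 9.1, Def. 9.2, Prop. 9.3,
  (9.7); §9.2, proof of Prop. 9.3. [Bamler2020Entropy]
* R. H. Bamler, *Compactness theory of the space of super Ricci flows*, Invent. Math. 233 (2023),
  1121–1277 (arXiv:2008.09298), §3.2, Proposition (b); §3.5, Definitions (`P*`-parabolic
  neighborhood), (`P*`-parabolic ball), Proposition. [Bamler2023]
-/

noncomputable section

open Set MeasureTheory Filter TopologicalSpace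
open scoped Topology ENNReal NNReal

namespace Literature.Geometry.Riemannian

universe u

namespace MetricFlow

variable {I : Set ℝ} {𝒳 : MetricFlow.{u} I}

/-- Time-slices are second countable (separable metric spaces). [folklore] -/
instance secondCountableTopology_slice (t : I) : SecondCountableTopology (𝒳.Slice t) :=
  UniformSpace.secondCountable_of_separable _

/-! ### Monotonicity of `d_{W₁}` between the conjugate heat kernels of two points -/

variable (𝒳) in
/-- The conjugate heat kernel `s ↦ ν_{x;s}` of `x ∈ 𝒳_t` is a conjugate heat flow over
`I ∩ (−∞, t']` for every `t' ≤ t` (reproduction formula).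
[cite: Bamler2023, §3.2, Definition (conjugate heat flow)] -/
theorem isConjugateHeatFlow_condKernel_of_le {t' t : I} (h : (t' : ℝ) ≤ t) (x : 𝒳.Slice t) :
    𝒳.IsConjugateHeatFlow (I ∩ Iic (t' : ℝ)) (fun s ↦ 𝒳.condKernel x s) := by
  refine ⟨fun s hs ↦ 𝒳.isProbabilityMeasure_condKernel x (le_trans (mem_Iic.1 hs.2) h), ?_⟩
  intro s₁ s₂ _ hs₂ h12 S hS
  exact 𝒳.reproduction h12 (le_trans (mem_Iic.1 hs₂.2) h) x S hS

/-- **Monotonicity of `d_{W₁}` between two conjugate heat kernels** (Bamler 2020a, §2.4, Lemma;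
Bamler 2023, §3.2, Proposition (b) for `(ν_{x₁;s})_s`, `(ν_{x₂;s})_s`): in an `H`-concentrated
metric flow, for `x₁ ∈ 𝒳_{t₁}`, `x₂ ∈ 𝒳_{t₂}` and `s ≤ s' ≤ min(t₁, t₂)`,
`d^{𝒳_s}_{W₁}(ν_{x₁;s}, ν_{x₂;s}) ≤ d^{𝒳_{s'}}_{W₁}(ν_{x₁;s'}, ν_{x₂;s'})` (finite variances by
`H`-concentration). [cite: Bamler2020Entropy, §2.4, Lemma (monotonicity of the W1-distance)] -/
theorem IsHConcentrated.wassersteinW1_condKernel_mono' {H : ℝ} (hH : 𝒳.IsHConcentrated H)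
    {s s' t₁ t₂ : I} (hss' : (s : ℝ) ≤ s') (h₁ : (s' : ℝ) ≤ t₁) (h₂ : (s' : ℝ) ≤ t₂)
    (x₁ : 𝒳.Slice t₁) (x₂ : 𝒳.Slice t₂) :
    wassersteinW1 (𝒳.condKernel x₁ s) (𝒳.condKernel x₂ s) ≤
      wassersteinW1 (𝒳.condKernel x₁ s') (𝒳.condKernel x₂ s') :=
  IsConjugateHeatFlow.wassersteinW1_mono_of_variance_ne_top (t₁ := s) (t₂ := s')
    (𝒳.isConjugateHeatFlow_condKernel_of_le h₁ x₁) (𝒳.isConjugateHeatFlow_condKernel_of_le h₂ x₂)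
    ⟨s.2, hss'⟩ ⟨s'.2, le_refl (s' : ℝ)⟩ hss'
    (ne_top_of_le_ne_top ENNReal.ofReal_ne_top
      (hH.variance_condKernel_self_le_ofReal (hss'.trans h₁) x₁))
    (ne_top_of_le_ne_top ENNReal.ofReal_ne_top
      (hH.variance_condKernel_self_le_ofReal (hss'.trans h₂) x₂))

/-- **The estimate behind Prop. 9.3 (c)** (Bamler 2020a, §9.2, proof of (c), display): for
`x ∈ 𝒳_t`, `x₁ ∈ 𝒳_{t₁}`, `x₂ ∈ 𝒳_{t₂}` and times `s ≤ s₁ ≤ min(t, t₁)`, `s ≤ s₂ ≤ min(t₁, t₂)`,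
`d^{s}_{W₁}(ν_{x₂;s}, ν_{x;s}) ≤ d^{s}_{W₁}(ν_{x₂;s}, ν_{x₁;s}) + d^{s}_{W₁}(ν_{x₁;s}, ν_{x;s})
≤ d^{s₂}_{W₁}(ν_{x₂;s₂}, ν_{x₁;s₂}) + d^{s₁}_{W₁}(ν_{x₁;s₁}, ν_{x;s₁})` (triangle inequality, then
monotonicity), in an `H`-concentrated flow.
[cite: Bamler2020Entropy, §9.2, proof of Prop. 9.3 (c)] -/
theorem wassersteinW1_condKernel_le_add {H : ℝ} (hH : 𝒳.IsHConcentrated H)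
    {s s₁ s₂ t t₁ t₂ : I} (hs₁ : (s : ℝ) ≤ s₁) (hs₂ : (s : ℝ) ≤ s₂) (h₁t : (s₁ : ℝ) ≤ t)
    (h₁t₁ : (s₁ : ℝ) ≤ t₁) (h₂t₁ : (s₂ : ℝ) ≤ t₁) (h₂t₂ : (s₂ : ℝ) ≤ t₂)
    (x : 𝒳.Slice t) (x₁ : 𝒳.Slice t₁) (x₂ : 𝒳.Slice t₂) :
    wassersteinW1 (𝒳.condKernel x₂ s) (𝒳.condKernel x s) ≤
      wassersteinW1 (𝒳.condKernel x₂ s₂) (𝒳.condKernel x₁ s₂) +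
        wassersteinW1 (𝒳.condKernel x₁ s₁) (𝒳.condKernel x s₁) := by
  haveI := 𝒳.isProbabilityMeasure_condKernel x₂ (hs₂.trans h₂t₂)
  haveI := 𝒳.isProbabilityMeasure_condKernel x (hs₁.trans h₁t)
  calc wassersteinW1 (𝒳.condKernel x₂ s) (𝒳.condKernel x s)
      ≤ wassersteinW1 (𝒳.condKernel x₂ s) (𝒳.condKernel x₁ s) +
          wassersteinW1 (𝒳.condKernel x₁ s) (𝒳.condKernel x s) := wassersteinW1_triangle _ _ _
    _ ≤ _ := add_le_add (hH.wassersteinW1_condKernel_mono' hs₂ h₂t₂ h₂t₁ x₂ x₁)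
        (hH.wassersteinW1_condKernel_mono' hs₁ h₁t₁ h₁t x₁ x)

/-! ### Def. 9.2: forward and backward `P*`-parabolic balls; time-slices (9.7) -/

variable (𝒳) in
/-- **Forward `P*`-parabolic ball** `P*⁺(x; r) := P*(x; r, 0, r²)` (Bamler 2020a, Def. 9.2; Bamler
2023, §3.5); always defined, the base time being `𝔱(x) ∈ I`.
[cite: Bamler2020Entropy, §9.1, Def. 9.2] -/
def pParabolicBallFwd (x : 𝒳.Pt) (r : ℝ) : Set 𝒳.Pt :=
  𝒳.pParabolicNhd x r 0 (r ^ 2) (by rw [sub_zero]; exact x.1.2)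

variable (𝒳) in
/-- **Backward `P*`-parabolic ball** `P*⁻(x; r) := P*(x; r, −r², 0)`, defined when `𝔱(x) − r² ∈ I`
(Bamler 2020a, Def. 9.2; Bamler 2023, §3.5). [cite: Bamler2020Entropy, §9.1, Def. 9.2] -/
def pParabolicBallBwd (x : 𝒳.Pt) (r : ℝ) (h : (x.1 : ℝ) - r ^ 2 ∈ I) : Set 𝒳.Pt :=
  𝒳.pParabolicNhd x r (r ^ 2) 0 h

variable (𝒳) in
/-- **Time-slice of a `P*`-parabolic neighbourhood**, `S_t := P*(x; A, −T⁻, T⁺) ∩ 𝒳_t` as a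
subset of the slice `𝒳_t` (Bamler 2020a, (9.7)). [cite: Bamler2020Entropy, §9.1, (9.7)] -/
def pParabolicNhdSlice (x : 𝒳.Pt) (A Tm Tp : ℝ) (h : (x.1 : ℝ) - Tm ∈ I) (t : I) :
    Set (𝒳.Slice t) :=
  {y | (⟨t, y⟩ : 𝒳.Pt) ∈ 𝒳.pParabolicNhd x A Tm Tp h}

/-- Membership in `P*(x₀; A, −T⁻, T⁺)`, unfolded: `𝔱(x) ∈ [𝔱(x₀) − T⁻, 𝔱(x₀) + T⁺]` and
`d_{W₁}(ν_{x₀;𝔱(x₀)−T⁻}, ν_{x;𝔱(x₀)−T⁻}) < A`. [cite: Bamler2020Entropy, §9.1, Def. 9.1] -/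
theorem mem_pParabolicNhd_iff {x₀ x : 𝒳.Pt} {A Tm Tp : ℝ} {h : (x₀.1 : ℝ) - Tm ∈ I} :
    x ∈ 𝒳.pParabolicNhd x₀ A Tm Tp h ↔
      ((x₀.1 : ℝ) - Tm ≤ x.1 ∧ (x.1 : ℝ) ≤ x₀.1 + Tp) ∧
        wassersteinW1 (𝒳.condKernel x₀.2 ⟨(x₀.1 : ℝ) - Tm, h⟩)
          (𝒳.condKernel x.2 ⟨(x₀.1 : ℝ) - Tm, h⟩) < ENNReal.ofReal A :=
  Iff.rfl

/-- Membership in `P*(x₀; A, −T⁻, T⁺)` in terms of any name `s₀ ∈ I` of the base time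
`𝔱(x₀) − T⁻`. [cite: Bamler2020Entropy, §9.1, Def. 9.1] -/
theorem mem_pParabolicNhd_iff_of_coe_eq {x₀ x : 𝒳.Pt} {A Tm Tp : ℝ} (h : (x₀.1 : ℝ) - Tm ∈ I)
    {s₀ : I} (hs₀ : (s₀ : ℝ) = x₀.1 - Tm) :
    x ∈ 𝒳.pParabolicNhd x₀ A Tm Tp h ↔
      ((s₀ : ℝ) ≤ x.1 ∧ (x.1 : ℝ) ≤ x₀.1 + Tp) ∧
        wassersteinW1 (𝒳.condKernel x₀.2 s₀) (𝒳.condKernel x.2 s₀) < ENNReal.ofReal A := by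
  obtain ⟨s₀, hs₀'⟩ := s₀; simp only at hs₀; subst hs₀; exact Iff.rfl

/-- Membership in the time-slice `S_t` of `P*(x₀; A, −T⁻, T⁺)`, unfolded:
`t ∈ [𝔱(x₀) − T⁻, 𝔱(x₀) + T⁺]` and `d_{W₁}(ν_{x₀;𝔱(x₀)−T⁻}, ν_{y;𝔱(x₀)−T⁻}) < A`.
[cite: Bamler2020Entropy, §9.1, (9.7)] -/
theorem mem_pParabolicNhdSlice_iff {x₀ : 𝒳.Pt} {A Tm Tp : ℝ} {h : (x₀.1 : ℝ) - Tm ∈ I} {t : I}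
    {y : 𝒳.Slice t} :
    y ∈ 𝒳.pParabolicNhdSlice x₀ A Tm Tp h t ↔
      ((x₀.1 : ℝ) - Tm ≤ t ∧ (t : ℝ) ≤ x₀.1 + Tp) ∧
        wassersteinW1 (𝒳.condKernel x₀.2 ⟨(x₀.1 : ℝ) - Tm, h⟩)
          (𝒳.condKernel y ⟨(x₀.1 : ℝ) - Tm, h⟩) < ENNReal.ofReal A :=
  Iff.rfl

/-- A point `x` lies in `P*(x₀; A, −T⁻, T⁺)` iff it lies in the time-slice `S_{𝔱(x)}`.
[cite: Bamler2020Entropy, §9.1, (9.7)] -/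
theorem mem_pParabolicNhd_iff_mem_pParabolicNhdSlice {x₀ x : 𝒳.Pt} {A Tm Tp : ℝ}
    {h : (x₀.1 : ℝ) - Tm ∈ I} :
    x ∈ 𝒳.pParabolicNhd x₀ A Tm Tp h ↔ x.2 ∈ 𝒳.pParabolicNhdSlice x₀ A Tm Tp h x.1 :=
  Iff.rfl

/-- `P*⁻(x₀; r) ⊆ P*(x₀; r)` (same base time, `0 ≤ r²`).
[cite: Bamler2020Entropy, §9.1, Def. 9.2] -/
theorem pParabolicBallBwd_subset_pParabolicBall (x₀ : 𝒳.Pt) (r : ℝ) (h : (x₀.1 : ℝ) - r ^ 2 ∈ I) :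
    𝒳.pParabolicBallBwd x₀ r h ⊆ 𝒳.pParabolicBall x₀ r h := fun _ hx ↦
  ⟨⟨hx.1.1, hx.1.2.trans (by nlinarith)⟩, hx.2⟩

/-- An inhabited `P*`-neighbourhood has `A > 0`. [cite: Bamler2020Entropy, §9.1, Def. 9.1] -/
theorem pos_of_mem_pParabolicNhd {x₀ x : 𝒳.Pt} {A Tm Tp : ℝ} {h : (x₀.1 : ℝ) - Tm ∈ I}
    (hx : x ∈ 𝒳.pParabolicNhd x₀ A Tm Tp h) : 0 < A :=
  ENNReal.ofReal_pos.1 (zero_le.trans_lt hx.2)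

/-- **`x ∈ P*(x; A, −T⁻, T⁺)`** for `A > 0`, `T^± ≥ 0` (`d_{W₁}(ν, ν) = 0`; Bamler 2023, §3.6,
Proposition (d)). [cite: Bamler2023, §3.6, Proposition (properties of the natural topology), (d)] -/
theorem mem_pParabolicNhd_self (x : 𝒳.Pt) {A Tm Tp : ℝ} (hA : 0 < A) (hTm : 0 ≤ Tm) (hTp : 0 ≤ Tp)
    (h : (x.1 : ℝ) - Tm ∈ I) : x ∈ 𝒳.pParabolicNhd x A Tm Tp h := by
  haveI := 𝒳.isProbabilityMeasure_condKernel (s := ⟨(x.1 : ℝ) - Tm, h⟩) x.2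
    (show (x.1 : ℝ) - Tm ≤ x.1 by linarith)
  rw [mem_pParabolicNhd_iff, wassersteinW1_self]
  exact ⟨⟨by linarith, by linarith⟩, ENNReal.ofReal_pos.2 hA⟩

/-! ### Prop. 9.3 (a): `P*(x₀; A, 0, 0) = B(x₀, A) × {𝔱(x₀)}` -/

/-- **Prop. 9.3 (a)**: `P*(x₀; A, 0, 0) ∩ 𝒳_{𝔱(x₀)} = B(x₀, A)` (`ν_{x;𝔱(x)} = δ_x` and
`d_{W₁}(δ_x, δ_y) = d(x, y)`). [cite: Bamler2020Entropy, §9.1, Prop. 9.3 (a)] -/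
theorem pParabolicNhdSlice_zero_zero_self (x₀ : 𝒳.Pt) (A : ℝ) (h : (x₀.1 : ℝ) - 0 ∈ I) :
    𝒳.pParabolicNhdSlice x₀ A 0 0 h x₀.1 = Metric.ball x₀.2 A := by
  have e : (⟨(x₀.1 : ℝ) - 0, h⟩ : I) = x₀.1 := Subtype.ext (sub_zero _)
  ext y
  rw [mem_pParabolicNhdSlice_iff, Metric.mem_ball', e, 𝒳.condKernel_self, 𝒳.condKernel_self,
    wassersteinW1_dirac_dirac, edist_dist, ENNReal.ofReal_lt_ofReal_iff_of_nonneg dist_nonneg]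
  simp

/-- **Prop. 9.3 (a)**, the times: every point of `P*(x₀; A, 0, 0)` lies in the slice of `x₀`.
[cite: Bamler2020Entropy, §9.1, Prop. 9.3 (a)] -/
theorem fst_eq_of_mem_pParabolicNhd_zero_zero {x₀ x : 𝒳.Pt} {A : ℝ} {h : (x₀.1 : ℝ) - 0 ∈ I}
    (hx : x ∈ 𝒳.pParabolicNhd x₀ A 0 0 h) : x.1 = x₀.1 :=
  Subtype.ext (le_antisymm (by linarith [hx.1.2]) (by linarith [hx.1.1]))

/-! ### Prop. 9.3 (b)–(d) in an `H`-concentrated metric flow -/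

/-- **Prop. 9.3 (b)** (monotonicity): for `A₁ ≤ A₂`, `0 ≤ T₁⁻ ≤ T₂⁻`, `T₁⁺ ≤ T₂⁺`,
`P*(x; A₁, −T₁⁻, T₁⁺) ⊆ P*(x; A₂, −T₂⁻, T₂⁺)` (going to the earlier base time `𝔱(x) − T₂⁻` does
not increase `d_{W₁}`). [cite: Bamler2020Entropy, §9.1, Prop. 9.3 (b)] -/
theorem IsHConcentrated.pParabolicNhd_mono {H : ℝ} (hH : 𝒳.IsHConcentrated H) (x : 𝒳.Pt)
    {A₁ A₂ T₁ T₂ T₁' T₂' : ℝ} (hA : A₁ ≤ A₂) (hT₁ : 0 ≤ T₁) (hT : T₁ ≤ T₂) (hT' : T₁' ≤ T₂')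
    (h₁ : (x.1 : ℝ) - T₁ ∈ I) (h₂ : (x.1 : ℝ) - T₂ ∈ I) :
    𝒳.pParabolicNhd x A₁ T₁ T₁' h₁ ⊆ 𝒳.pParabolicNhd x A₂ T₂ T₂' h₂ := by
  intro x' hx'
  obtain ⟨⟨ht₁, ht₂⟩, hW⟩ := hx'
  refine ⟨⟨by linarith, by linarith⟩, lt_of_le_of_lt ?_ (hW.trans_le (ENNReal.ofReal_le_ofReal hA))⟩
  exact hH.wassersteinW1_condKernel_mono' (show (x.1 : ℝ) - T₂ ≤ x.1 - T₁ by linarith)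
    (show (x.1 : ℝ) - T₁ ≤ x.1 by linarith) ht₁ x.2 x'.2

/-- **Prop. 9.3 (bb)**, first half (symmetry): if `x₁ ∈ P*(x₂; A, −T⁻, T⁺)` (`T⁻ ≥ 0`), then
`x₂ ∈ P*(x₁; A', −T'⁻, T'⁺)` whenever `A ≤ A'`, `T⁻ + T⁺ ≤ T'⁻`, `T⁻ ≤ T'⁺` (the source: `A' = A`,
`T'⁻ = T⁻ + T⁺`, `T'⁺ = T⁻`; `𝔱(x₁) − T'⁻ ≤ 𝔱(x₂) − T⁻`).
[cite: Bamler2020Entropy, §9.1, Prop. 9.3 (bb)] -/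
theorem IsHConcentrated.mem_pParabolicNhd_comm {H : ℝ} (hH : 𝒳.IsHConcentrated H) {x₁ x₂ : 𝒳.Pt}
    {A Tm Tp A' Tm' Tp' : ℝ} (hTm : 0 ≤ Tm) {h₂ : (x₂.1 : ℝ) - Tm ∈ I}
    (hx : x₁ ∈ 𝒳.pParabolicNhd x₂ A Tm Tp h₂) (hA : A ≤ A') (hTm' : Tm + Tp ≤ Tm')
    (hTp' : Tm ≤ Tp') (h₁ : (x₁.1 : ℝ) - Tm' ∈ I) :
    x₂ ∈ 𝒳.pParabolicNhd x₁ A' Tm' Tp' h₁ := by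
  obtain ⟨⟨ht₁, ht₂⟩, hW⟩ := hx
  refine ⟨⟨by linarith, by linarith⟩, ?_⟩
  calc wassersteinW1 (𝒳.condKernel x₁.2 ⟨_, h₁⟩) (𝒳.condKernel x₂.2 ⟨_, h₁⟩)
      ≤ wassersteinW1 (𝒳.condKernel x₁.2 ⟨_, h₂⟩) (𝒳.condKernel x₂.2 ⟨_, h₂⟩) :=
        hH.wassersteinW1_condKernel_mono' (show (x₁.1 : ℝ) - Tm' ≤ x₂.1 - Tm by linarith) ht₁
          (show (x₂.1 : ℝ) - Tm ≤ x₂.1 by linarith) x₁.2 x₂.2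
    _ < ENNReal.ofReal A' := by
        rw [wassersteinW1_comm]; exact hW.trans_le (ENNReal.ofReal_le_ofReal hA)

/-- **Prop. 9.3 (bb)**, second half: if `x₁ ∈ P*(x₂; A, −T⁻, T⁺)`, then
`P*(x₂; A, −T⁻, T⁺) ⊆ P*(x₁; A', −T'⁻, T'⁺)` whenever `2A ≤ A'`, `T⁻ + T⁺ ≤ T'⁻`, `T⁻ + T⁺ ≤ T'⁺`
(the source: `A' = 2A`, `T'^± = T⁻ + T⁺`; monotonicity to the base time `𝔱(x₂) − T⁻`, triangle
inequality through `ν_{x₂;𝔱(x₂)−T⁻}`). [cite: Bamler2020Entropy, §9.1, Prop. 9.3 (bb)] -/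
theorem IsHConcentrated.pParabolicNhd_subset_of_mem_comm {H : ℝ} (hH : 𝒳.IsHConcentrated H)
    {x₁ x₂ : 𝒳.Pt} {A Tm Tp A' Tm' Tp' : ℝ} {h₂ : (x₂.1 : ℝ) - Tm ∈ I}
    (hx : x₁ ∈ 𝒳.pParabolicNhd x₂ A Tm Tp h₂) (hA : 2 * A ≤ A') (hTm' : Tm + Tp ≤ Tm')
    (hTp' : Tm + Tp ≤ Tp') (h₁ : (x₁.1 : ℝ) - Tm' ∈ I) :
    𝒳.pParabolicNhd x₂ A Tm Tp h₂ ⊆ 𝒳.pParabolicNhd x₁ A' Tm' Tp' h₁ := by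
  intro x hx'
  have hA0 : 0 < A := pos_of_mem_pParabolicNhd hx
  obtain ⟨⟨ht₁, ht₂⟩, hW⟩ := hx
  obtain ⟨⟨ht₁', ht₂'⟩, hW'⟩ := hx'
  refine ⟨⟨by linarith, by linarith⟩, ?_⟩
  haveI := 𝒳.isProbabilityMeasure_condKernel (s := ⟨_, h₂⟩) x₁.2 ht₁
  haveI := 𝒳.isProbabilityMeasure_condKernel (s := ⟨_, h₂⟩) x.2 ht₁'
  calc wassersteinW1 (𝒳.condKernel x₁.2 ⟨_, h₁⟩) (𝒳.condKernel x.2 ⟨_, h₁⟩)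
      ≤ wassersteinW1 (𝒳.condKernel x₁.2 ⟨_, h₂⟩) (𝒳.condKernel x.2 ⟨_, h₂⟩) :=
        hH.wassersteinW1_condKernel_mono' (show (x₁.1 : ℝ) - Tm' ≤ x₂.1 - Tm by linarith) ht₁
          ht₁' x₁.2 x.2
    _ ≤ wassersteinW1 (𝒳.condKernel x₁.2 ⟨_, h₂⟩) (𝒳.condKernel x₂.2 ⟨_, h₂⟩) +
          wassersteinW1 (𝒳.condKernel x₂.2 ⟨_, h₂⟩) (𝒳.condKernel x.2 ⟨_, h₂⟩) :=
        wassersteinW1_triangle _ _ _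
    _ < ENNReal.ofReal A + ENNReal.ofReal A := by
        rw [wassersteinW1_comm (𝒳.condKernel x₁.2 _)]; exact ENNReal.add_lt_add hW hW'
    _ = ENNReal.ofReal (2 * A) := by rw [two_mul, ENNReal.ofReal_add hA0.le hA0.le]
    _ ≤ ENNReal.ofReal A' := ENNReal.ofReal_le_ofReal hA

/-- **Prop. 9.3 (c)** (transitivity): if `x₁ ∈ P*(x₂; A₂, −T₂⁻, T₂⁺)` (`T₁⁻, T₂⁻ ≥ 0`), then
`P*(x₁; A₁, −T₁⁻, T₁⁺) ⊆ P*(x₂; A, −T⁻, T⁺)` whenever `A₁ + A₂ ≤ A`, `T₁⁻ + T₂⁻ ≤ T⁻`,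
`T₁⁺ + T₂⁺ ≤ T⁺` (the source: equalities; `wassersteinW1_condKernel_le_add` at the base time
`𝔱(x₂) − T⁻`). [cite: Bamler2020Entropy, §9.1, Prop. 9.3 (c)] -/
theorem IsHConcentrated.pParabolicNhd_subset_of_mem {H : ℝ} (hH : 𝒳.IsHConcentrated H)
    {x₁ x₂ : 𝒳.Pt} {A₁ A₂ T₁ T₂ T₁' T₂' A T T' : ℝ} (hT₁ : 0 ≤ T₁) (hT₂ : 0 ≤ T₂)
    {h₂ : (x₂.1 : ℝ) - T₂ ∈ I} (hx : x₁ ∈ 𝒳.pParabolicNhd x₂ A₂ T₂ T₂' h₂) (hA : A₁ + A₂ ≤ A)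
    (hT : T₁ + T₂ ≤ T) (hT' : T₁' + T₂' ≤ T') (h₁ : (x₁.1 : ℝ) - T₁ ∈ I)
    (h : (x₂.1 : ℝ) - T ∈ I) :
    𝒳.pParabolicNhd x₁ A₁ T₁ T₁' h₁ ⊆ 𝒳.pParabolicNhd x₂ A T T' h := by
  intro x hx'
  have hA₁ := pos_of_mem_pParabolicNhd hx'; have hA₂ := pos_of_mem_pParabolicNhd hx
  obtain ⟨⟨ht₁, ht₂⟩, hW⟩ := hx
  obtain ⟨⟨ht₁', ht₂'⟩, hW'⟩ := hx'
  refine ⟨⟨by linarith, by linarith⟩, ?_⟩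
  calc wassersteinW1 (𝒳.condKernel x₂.2 ⟨_, h⟩) (𝒳.condKernel x.2 ⟨_, h⟩)
      ≤ wassersteinW1 (𝒳.condKernel x₂.2 ⟨_, h₂⟩) (𝒳.condKernel x₁.2 ⟨_, h₂⟩) +
          wassersteinW1 (𝒳.condKernel x₁.2 ⟨_, h₁⟩) (𝒳.condKernel x.2 ⟨_, h₁⟩) :=
        wassersteinW1_condKernel_le_add hH (show (x₂.1 : ℝ) - T ≤ x₁.1 - T₁ by linarith)
          (show (x₂.1 : ℝ) - T ≤ x₂.1 - T₂ by linarith) ht₁'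
          (show (x₁.1 : ℝ) - T₁ ≤ x₁.1 by linarith) ht₁ (show (x₂.1 : ℝ) - T₂ ≤ x₂.1 by linarith)
          x.2 x₁.2 x₂.2
    _ < ENNReal.ofReal A₂ + ENNReal.ofReal A₁ := ENNReal.add_lt_add hW hW'
    _ = ENNReal.ofReal (A₁ + A₂) := by rw [← ENNReal.ofReal_add hA₂.le hA₁.le, add_comm]
    _ ≤ ENNReal.ofReal A := ENNReal.ofReal_le_ofReal hA

/-- **Prop. 9.3 (d)** for general neighbourhoods ("(bb) then (c)" through a common point): if
`x ∈ P*(x₁; A₁, −T₁⁻, T₁⁺) ∩ P*(x₂; A₂, −T₂⁻, T₂⁺)` (`T₂⁻ ≥ 0`), then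
`P*(x₁; A₁, −T₁⁻, T₁⁺) ⊆ P*(x₂; A, −T⁻, T⁺)` whenever `2A₁ + A₂ ≤ A`, `T₁⁻ + T₁⁺ + T₂⁻ ≤ T⁻`,
`T₁⁻ + T₁⁺ + T₂⁺ ≤ T⁺` (`d^{s}_{W₁}(ν_{x₂}, ν_{x'}) ≤ d^{s₂}_{W₁}(ν_{x₂}, ν_x) +
d^{s₁}_{W₁}(ν_x, ν_{x₁}) + d^{s₁}_{W₁}(ν_{x₁}, ν_{x'}) < A₂ + 2A₁`).
[cite: Bamler2020Entropy, §9.2, proof of Prop. 9.3 (d)] -/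
theorem IsHConcentrated.pParabolicNhd_subset_of_mem_of_mem {H : ℝ} (hH : 𝒳.IsHConcentrated H)
    {x₁ x₂ x : 𝒳.Pt} {A₁ A₂ T₁ T₂ T₁' T₂' A T T' : ℝ} (hT₂ : 0 ≤ T₂)
    {h₁ : (x₁.1 : ℝ) - T₁ ∈ I} {h₂ : (x₂.1 : ℝ) - T₂ ∈ I}
    (hx₁ : x ∈ 𝒳.pParabolicNhd x₁ A₁ T₁ T₁' h₁) (hx₂ : x ∈ 𝒳.pParabolicNhd x₂ A₂ T₂ T₂' h₂)
    (hA : 2 * A₁ + A₂ ≤ A) (hT : T₁ + T₁' + T₂ ≤ T) (hT' : T₁ + T₁' + T₂' ≤ T')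
    (h : (x₂.1 : ℝ) - T ∈ I) :
    𝒳.pParabolicNhd x₁ A₁ T₁ T₁' h₁ ⊆ 𝒳.pParabolicNhd x₂ A T T' h := by
  intro x' hx'
  have hA₁ := pos_of_mem_pParabolicNhd hx₁; have hA₂ := pos_of_mem_pParabolicNhd hx₂
  obtain ⟨⟨h1a, h1b⟩, hW₁⟩ := hx₁
  obtain ⟨⟨h2a, h2b⟩, hW₂⟩ := hx₂
  obtain ⟨⟨h3a, h3b⟩, hW₃⟩ := hx'
  refine ⟨⟨by linarith, by linarith⟩, ?_⟩
  haveI := 𝒳.isProbabilityMeasure_condKernel (s := ⟨_, h₁⟩) x.2 h1a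
  haveI := 𝒳.isProbabilityMeasure_condKernel (s := ⟨_, h₁⟩) x'.2 h3a
  -- the triangle inequality at the base time `𝔱(x₁) − T₁⁻` through `ν_x`
  have htri : wassersteinW1 (𝒳.condKernel x.2 ⟨_, h₁⟩) (𝒳.condKernel x'.2 ⟨_, h₁⟩) <
      ENNReal.ofReal A₁ + ENNReal.ofReal A₁ := by
    refine (wassersteinW1_triangle _ (𝒳.condKernel x₁.2 ⟨_, h₁⟩) _).trans_lt ?_
    rw [wassersteinW1_comm]
    exact ENNReal.add_lt_add hW₁ hW₃
  calc wassersteinW1 (𝒳.condKernel x₂.2 ⟨_, h⟩) (𝒳.condKernel x'.2 ⟨_, h⟩)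
      ≤ wassersteinW1 (𝒳.condKernel x₂.2 ⟨_, h₂⟩) (𝒳.condKernel x.2 ⟨_, h₂⟩) +
          wassersteinW1 (𝒳.condKernel x.2 ⟨_, h₁⟩) (𝒳.condKernel x'.2 ⟨_, h₁⟩) :=
        wassersteinW1_condKernel_le_add hH (show (x₂.1 : ℝ) - T ≤ x₁.1 - T₁ by linarith)
          (show (x₂.1 : ℝ) - T ≤ x₂.1 - T₂ by linarith) h3a h1a h2a
          (show (x₂.1 : ℝ) - T₂ ≤ x₂.1 by linarith) x'.2 x.2 x₂.2
    _ < ENNReal.ofReal A₂ + (ENNReal.ofReal A₁ + ENNReal.ofReal A₁) := ENNReal.add_lt_add hW₂ htri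
    _ = ENNReal.ofReal (2 * A₁ + A₂) := by
        rw [← ENNReal.ofReal_add hA₁.le hA₁.le, ← ENNReal.ofReal_add hA₂.le (by positivity)]
        congr 1
        ring
    _ ≤ ENNReal.ofReal A := ENNReal.ofReal_le_ofReal hA

/-- **Prop. 9.3 (bb) for balls**: `x₁ ∈ P*(x₂; r)` implies `x₂ ∈ P*(x₁; √2 r)`.
[cite: Bamler2020Entropy, §9.1, Prop. 9.3 (bb)] -/
theorem IsHConcentrated.mem_pParabolicBall_comm {H : ℝ} (hH : 𝒳.IsHConcentrated H)
    {x₁ x₂ : 𝒳.Pt} {r : ℝ} {h₂ : (x₂.1 : ℝ) - r ^ 2 ∈ I} (hx : x₁ ∈ 𝒳.pParabolicBall x₂ r h₂)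
    (h₁ : (x₁.1 : ℝ) - (Real.sqrt 2 * r) ^ 2 ∈ I) :
    x₂ ∈ 𝒳.pParabolicBall x₁ (Real.sqrt 2 * r) h₁ := by
  have hr : 0 < r := pos_of_mem_pParabolicNhd hx
  have h2 : (Real.sqrt 2 * r) ^ 2 = 2 * r ^ 2 := by rw [mul_pow, Real.sq_sqrt zero_le_two]
  refine hH.mem_pParabolicNhd_comm (sq_nonneg r) hx
    (le_mul_of_one_le_left hr.le Real.one_lt_sqrt_two.le) ?_ ?_ h₁ <;> rw [h2] <;> nlinarith

/-- **Prop. 9.3 (bb) for balls**: `x₁ ∈ P*(x₂; r)` implies `P*(x₂; r) ⊆ P*(x₁; 2r)`.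
[cite: Bamler2020Entropy, §9.1, Prop. 9.3 (bb)] -/
theorem IsHConcentrated.pParabolicBall_subset_of_mem_comm {H : ℝ} (hH : 𝒳.IsHConcentrated H)
    {x₁ x₂ : 𝒳.Pt} {r : ℝ} {h₂ : (x₂.1 : ℝ) - r ^ 2 ∈ I} (hx : x₁ ∈ 𝒳.pParabolicBall x₂ r h₂)
    (h₁ : (x₁.1 : ℝ) - (2 * r) ^ 2 ∈ I) :
    𝒳.pParabolicBall x₂ r h₂ ⊆ 𝒳.pParabolicBall x₁ (2 * r) h₁ := by
  have hr : 0 < r := pos_of_mem_pParabolicNhd hx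
  exact hH.pParabolicNhd_subset_of_mem_comm hx le_rfl (by nlinarith) (by nlinarith) h₁

/-- **Prop. 9.3 (c) for balls**: `x₁ ∈ P*(x₂; r₂)` implies `P*(x₁; r₁) ⊆ P*(x₂; r₁ + r₂)`.
[cite: Bamler2020Entropy, §9.1, Prop. 9.3 (c)] -/
theorem IsHConcentrated.pParabolicBall_subset_of_mem {H : ℝ} (hH : 𝒳.IsHConcentrated H)
    {x₁ x₂ : 𝒳.Pt} {r₁ r₂ : ℝ} {h₂ : (x₂.1 : ℝ) - r₂ ^ 2 ∈ I} (hx : x₁ ∈ 𝒳.pParabolicBall x₂ r₂ h₂)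
    (h₁ : (x₁.1 : ℝ) - r₁ ^ 2 ∈ I) (h : (x₂.1 : ℝ) - (r₁ + r₂) ^ 2 ∈ I) :
    𝒳.pParabolicBall x₁ r₁ h₁ ⊆ 𝒳.pParabolicBall x₂ (r₁ + r₂) h := by
  intro x hx'
  have hr₁ := pos_of_mem_pParabolicNhd hx'; have hr₂ := pos_of_mem_pParabolicNhd hx
  exact hH.pParabolicNhd_subset_of_mem (sq_nonneg r₁) (sq_nonneg r₂) hx le_rfl (by nlinarith)
    (by nlinarith) h₁ h hx'

/-- **Prop. 9.3 (d)**: if `P*(x₁; r₁) ∩ P*(x₂; r₂) ≠ ∅`, then `P*(x₁; r₁) ⊆ P*(x₂; 2r₁ + r₂)`.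
[cite: Bamler2020Entropy, §9.1, Prop. 9.3 (d)] -/
theorem IsHConcentrated.pParabolicBall_subset_of_mem_of_mem {H : ℝ} (hH : 𝒳.IsHConcentrated H)
    {x₁ x₂ x : 𝒳.Pt} {r₁ r₂ : ℝ} {h₁ : (x₁.1 : ℝ) - r₁ ^ 2 ∈ I} {h₂ : (x₂.1 : ℝ) - r₂ ^ 2 ∈ I}
    (hx₁ : x ∈ 𝒳.pParabolicBall x₁ r₁ h₁) (hx₂ : x ∈ 𝒳.pParabolicBall x₂ r₂ h₂)
    (h : (x₂.1 : ℝ) - (2 * r₁ + r₂) ^ 2 ∈ I) :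
    𝒳.pParabolicBall x₁ r₁ h₁ ⊆ 𝒳.pParabolicBall x₂ (2 * r₁ + r₂) h := by
  have hr₁ := pos_of_mem_pParabolicNhd hx₁; have hr₂ := pos_of_mem_pParabolicNhd hx₂
  exact hH.pParabolicNhd_subset_of_mem_of_mem (sq_nonneg r₂) hx₁ hx₂ le_rfl (by nlinarith)
    (by nlinarith) h

/-- `P*⁺(x; r) ⊆ P*(x; r)` when the latter is defined (Prop. 9.3 (b) with `T₁⁻ = 0 ≤ r² = T₂⁻`).
[cite: Bamler2020Entropy, §9.1, Prop. 9.3 (b)] -/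
theorem IsHConcentrated.pParabolicBallFwd_subset_pParabolicBall {H : ℝ} (hH : 𝒳.IsHConcentrated H)
    (x : 𝒳.Pt) (r : ℝ) (h : (x.1 : ℝ) - r ^ 2 ∈ I) :
    𝒳.pParabolicBallFwd x r ⊆ 𝒳.pParabolicBall x r h :=
  hH.pParabolicNhd_mono x le_rfl le_rfl (sq_nonneg r) le_rfl _ h

end MetricFlow

end Literature.Geometry.Riemannian

end
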